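import Literature.Analysis.FunctionSpaces.TorusGevreySobolevBounds
import HarnessLib

/-!
# Sup-norm and Sobolev bounds on `T³` from a Gevrey bound (tools stub `stub_gevreySobolevBoundsTools`,
# block N E11, line `ergodic-budget-selection-closing`, crux `BaireTransfer.DenseLoudDesignerForces`,
# stmt-AnomalousDissipation-1143)

Summit-side specialisation to `T³ = UnitAddTorus (Fin 3)` of the Literature theorem
`Torus.exists_sobolevBounds_of_gevreyBound` (`Literature/Analysis/FunctionSpaces/TorusGevreySobolevBounds.lean`):
for `σ > 0` and `C` there is `B = B(σ, C)` such that every smooth `v : T³ → ℝ³` whose Fourier coefficients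
`v̂(k) = 𝓕(complexify ∘ v)(k)` obey the Gevrey bound `∑_{k∈S} e^{2σ|k|} ‖v̂(k)‖² ≤ C` for all finite `S ⊆ ℤ³`
(the Gevrey classes of Foias–Temam 1989, produced along bounded-enstrophy Navier–Stokes trajectories by the
neighbouring tools stub E9) satisfies the classical bounds consumed by the continuation, linearisation and
hyperbolicity-transfer steps of block N: `‖v(x)‖ ≤ B`, `‖∂ᵢv(x)‖ ≤ B`, `‖∇v‖₂² ≤ B`, `∫ ‖Δv‖² ≤ B`,
`‖∇Δv‖₂² ≤ B` and the fourth Sobolev sums `∑_{k∈S} (1 + |k|²)⁴ ‖v̂(k)‖² ≤ B`.  Proof (in the Literature file,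
general `d`): modewise `‖v̂(k)‖ ≤ √C e^{−σ|k|}`; polynomial weights are summable against `e^{−σ|k|}`
(`Torus.summable_one_add_freqNormSq_pow_mul_exp_neg`); the Fourier series of a smooth field and of its
derivatives (symbols `2πi kᵢ`, `−4π²|k|²`) converge to them pointwise, whence the sup bounds; the `L²` quantities
on the probability space `T³` are bounded by squares of sup bounds.  The registered tools stub
`stub_gevreySobolevBoundsTools` is proved BY NAME with exactly the registered signature.

References: Foias–Temam, *Gevrey class regularity for the solutions of the Navier–Stokes equations*,
J. Funct. Anal. 87 (1989); Grafakos, *Classical Fourier Analysis* (3rd ed., 2014) Props. 3.2.5, 3.2.6.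
-/

-- `Summit.<Summit>.<Problem>` is the tree's mandated summit-side namespace (CONVENTIONS §2); for this
-- single-conjunct summit the two coincide, so the duplicate is deliberate.
set_option linter.dupNamespace false

noncomputable section

open Set Function MeasureTheory Filter
open scoped InnerProductSpace

namespace Summit.AnomalousDissipation.AnomalousDissipation.Theorems.DenseLoudDesignerForces.Ergodic

-- (the header's `open Literature.Analysis.FluidPDE Literature.Analysis.FluidPDE.Torus` is omitted: this file
-- imports no FluidPDE module, the statement lives entirely in the FunctionSpaces vocabulary)
open Literature.Analysis.FunctionSpaces Literature.Analysis.FunctionSpaces.Torus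

/-- **Tools stub E11 of block N (`stub_gevreySobolevBoundsTools`, crux stmt-AnomalousDissipation-1143, line
`ergodic-budget-selection-closing`) — sup-norm and Sobolev bounds from a Gevrey bound on `T³`.**  For `σ > 0`
and `C` there is `B` such that every smooth `v : T³ → ℝ³` with `∑_{k∈S} e^{2σ|k|} ‖v̂(k)‖² ≤ C` for all finite
`S ⊆ ℤ³` satisfies `‖v(x)‖ ≤ B`, `‖∂ᵢv(x)‖ ≤ B`, `‖∇v‖₂² ≤ B`, `∫ ‖Δv‖² ≤ B`, `‖∇Δv‖₂² ≤ B` and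
`∑_{k∈S} (1 + |k|²)⁴ ‖v̂(k)‖² ≤ B` for all finite `S` (`Torus.exists_sobolevBounds_of_gevreyBound` at
`d = Fin 3`: modewise `‖v̂(k)‖ ≤ √C e^{−σ|k|}`, summable polynomial weights against `e^{−σ|k|}`, pointwise
convergence of the Fourier series of `v`, `∂ᵢv`, `Δv`, `∂ᵢΔv`, and `∫ ‖g‖² ≤ (sup ‖g‖)²` on the probability space
`T³`). [folklore] -/
theorem stub_gevreySobolevBoundsTools {σ C : ℝ} (hσ : 0 < σ) :
    ∃ B : ℝ, ∀ (v : (UnitAddTorus (Fin 3)) → (EuclideanSpace ℝ (Fin 3))), IsSmooth v →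
      (∀ S : Finset (Fin 3 → ℤ), ∑ k ∈ S, Real.exp (2 * σ * Real.sqrt (freqNormSq k)) *
        ‖UnitAddTorus.mFourierCoeff (EuclideanSpace.complexify ∘ v) k‖ ^ 2 ≤ C) →
      (∀ x, ‖v x‖ ≤ B) ∧ (∀ i, ∀ x, ‖partialDeriv i v x‖ ≤ B) ∧ gradNormSq v ≤ B ∧ (∫ x, ‖laplacian v x‖ ^ 2) ≤ B ∧
      gradNormSq (laplacian v) ≤ B ∧
      ∀ S : Finset (Fin 3 → ℤ), ∑ k ∈ S, (1 + freqNormSq k) ^ 4 * ‖UnitAddTorus.mFourierCoeff (EuclideanSpace.complexify ∘ v) k‖ ^ 2 ≤ B :=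
  exists_sobolevBounds_of_gevreyBound (d := Fin 3) hσ C

end Summit.AnomalousDissipation.AnomalousDissipation.Theorems.DenseLoudDesignerForces.Ergodic

end
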